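import Summits.QuantumFields.YangMills.Theorems.LuscherReductionTraceDoorOST
import Summits.QuantumFields.YangMills.Theorems.LuscherReductionRunningReductionOneSiteTailClosed
import HarnessLib

/-!
# Registered stub S-OSTL `stub_oneSiteTraceLimit : Stmt.stub_oneSiteTraceLimit` of line «twolattice»
# (crux `TwistedTraceScaling`, stmt-QuantumFields-20203) — BY NAME AND SIGNATURE, unconditional

Route `LuscherReduction` (owner ym-beyond-p1), child crux `TwistedTraceScaling` (stmt-QuantumFields-20203) of RED, registered
birth line «twolattice» (`pub/ym-beyond/p1-g20-files/Lines-twolattice.lean`, sha16 a5c3dbcbf75f28d1; `ledger skeleton check`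
2026-08-27T08:36:11Z registered the three stubs with signatures `Stmt.stub_<name>`).

The gate credits a stub landing only for the VERBATIM header `theorem stub_oneSiteTraceLimit : Stmt.stub_oneSiteTraceLimit := …`,
and the skeleton (a pub / `Cruxes/` file) is not importable from `Theorems/`.  This module therefore re-homes §1's statement
abbreviation `Stmt.stub_oneSiteTraceLimit` CHARACTER FOR CHARACTER (under the Theorems-side namespace
`…Theorems.FemtoTransferGap.TwoLattice`, so it cannot collide with the skeleton's `…Cruxes.TwistedTraceScaling.TwoLattice.Stmt.*`;
the two are syntactically identical under the same `open`s, hence interchangeable by `Iff.rfl`) and proves it with no hypothesis: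

  `stub_oneSiteTraceLimit := TraceDoor.oneSiteTraceLimit_of_oneSiteTail OST.oneSiteTail_proof`

— the glue of skeleton PART 8 «OST» re-homed by ym-infvol-p1 g4 (`…TraceDoorOST.lean`; inputs ONE = `oneSiteLevels_proof`,
crux 20007, and `LGS.levelGapSummable_all`) applied to the CLOSED child `OneSiteTail` (stmt-QuantumFields-20204,
`OST.oneSiteTail_proof`, ym-luscher-20007-p1 g4).  The same statement WITHOUT the `Stmt` wrapper is
`TraceDoor.oneSiteTraceLimit` (`Theorems/LuscherReductionTwistedTraceScalingOneSiteTraceLimit.lean`).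
Owner's discharge in the skeleton: `theorem stub_oneSiteTraceLimit : Stmt.stub_oneSiteTraceLimit :=
Summit.QuantumFields.YangMills.Theorems.FemtoTransferGap.TwoLattice.stub_oneSiteTraceLimit` (or import this module and delete
§1's third abbrev + §2's third stub).

`Stmt.stub_oneSiteTraceLimit` is a statement abbreviation WITH a kernel-closed witness in this very module (audit class
`proved-helper`), not a named fact: nothing under `Theorems/` takes it as a hypothesis.

HONEST FRAMING: the one-site (`L = 1`) trace law of the three-matrix `SU(2)` model — lattice quantum mechanics, femto rung R2b1;
nothing of TOWER (the RG statement), of BASE (fixed-lattice law), of infinite volume, of a gap, or of Clay.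
-/

set_option autoImplicit false

noncomputable section

namespace Summit.QuantumFields.YangMills.Theorems.FemtoTransferGap.TwoLattice

open Summit.QuantumFields.YangMills.Theorems.FemtoTransferGap
open Summit.QuantumFields.YangMills.Theorems.FemtoTransferGap.TraceDoor

/-- OSTL statement (VERBATIM `TwoLattice.Stmt.stub_oneSiteTraceLimit` of the registered skeleton sha16 a5c3dbcbf75f28d1 = KTR r8
`TT.OneSiteTraceLimit` over the tree `TraceDoor` objects): for `s > 0`, `ε > 0`, eventually in the one-site coupling `B`, every `T`
with `|T·λ_b(B) − s| ≤ λ_b(B)` has `|levelRatio 1 B T − hTraceRatio s| ≤ ε`.  Proved below (`stub_oneSiteTraceLimit`, which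
carries the citations); this abbreviation is a re-homed skeleton statement text over Summits-side objects, deliberately WITHOUT a
citation tag (a cited `Prop` abbreviation would be relocated to `Literature/`, where `levelRatio`/`hTraceRatio` do not exist). -/
abbrev Stmt.stub_oneSiteTraceLimit : Prop :=
  ∀ s : ℝ, 0 < s → ∀ ε : ℝ, 0 < ε → ∃ B0 : ℝ, ∀ B : ℝ, B0 ≤ B → ∀ T : ℕ,
    |(T : ℝ) * bareLambda B - s| ≤ bareLambda B → |levelRatio 1 B T - hTraceRatio s| ≤ ε

/-- ★ **Registered stub S-OSTL of line «twolattice», BY NAME, unconditional**: the one-site dyadic level ratio tends to Lüscher's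
`r_𝔥(s)` when `Tλ_b → s`.  Proof: PART 8 glue `oneSiteTraceLimit_of_oneSiteTail` (ONE + `LevelGapSummable` inside) at the closed
child `OST.oneSiteTail_proof`. [cite: Luscher1983, §3] [cite: Simon1983, Thm 1.1] -/
theorem stub_oneSiteTraceLimit : Stmt.stub_oneSiteTraceLimit :=
  oneSiteTraceLimit_of_oneSiteTail OST.oneSiteTail_proof

end Summit.QuantumFields.YangMills.Theorems.FemtoTransferGap.TwoLattice

end
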